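import Summits.MatrixMultiplication.OmegaCensus.DominoZ19StructSixArrC0
import HarnessLib

/-!
# The `y`-arrangement list of family `C` for the structural part-`6` route, `p = 19`: completeness decides, part 1 of 6 (independent of the other parts)

ω-census `pub-omega`, family (b3), seat pub-omega-group gen 25.  Framing: lottery ticket; floor = certified bounds/negative
ranges.  VALUE: per-prime kernel data of the structural part-`6` route WITHOUT the pigeonhole (`DominoZpZpStructSixWide*.lean`)
for `p = 19` — target: the OPEN census cell `(1,6,20)@361` (`A = ℤ₁₉²`) and every larger order with such a quotient; NOT progress on ω.

Per-representative kernel decides `(arr6Y2 19 k).all (· ∈ yscZ19s6)` restricted to `dY6` for 12 representatives.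
-/

namespace Summit.MatrixMultiplication.OmegaCensus

open ZpZpDomino

namespace ZpZpDomino

/-- Completeness at representative 0. [folklore] -/
theorem yscZ19s6_c0 : ((arr6Y2 19 [0,0,0,0,0,0,0,0,0,0,0,0,0,0,0,1,2,2,1]).all fun ys => !(dY6 ys) || yscZ19s6.contains ys) = true := by decide +kernel

/-- Completeness at representative 1. [folklore] -/
theorem yscZ19s6_c1 : ((arr6Y2 19 [0,0,0,0,0,0,0,0,0,0,0,0,0,0,0,2,3,1,0]).all fun ys => !(dY6 ys) || yscZ19s6.contains ys) = true := by decide +kernel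

/-- Completeness at representative 2. [folklore] -/
theorem yscZ19s6_c2 : ((arr6Y2 19 [0,0,0,0,0,0,0,0,0,0,0,0,0,0,1,1,2,1,1]).all fun ys => !(dY6 ys) || yscZ19s6.contains ys) = true := by decide +kernel

/-- Completeness at representative 3. [folklore] -/
theorem yscZ19s6_c3 : ((arr6Y2 19 [0,0,0,0,0,0,0,0,0,0,0,0,0,0,1,1,2,2,0]).all fun ys => !(dY6 ys) || yscZ19s6.contains ys) = true := by decide +kernel

/-- Completeness at representative 4. [folklore] -/
theorem yscZ19s6_c4 : ((arr6Y2 19 [0,0,0,0,0,0,0,0,0,0,0,0,0,0,1,2,1,1,1]).all fun ys => !(dY6 ys) || yscZ19s6.contains ys) = true := by decide +kernel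

/-- Completeness at representative 5. [folklore] -/
theorem yscZ19s6_c5 : ((arr6Y2 19 [0,0,0,0,0,0,0,0,0,0,0,0,0,0,1,2,2,1,0]).all fun ys => !(dY6 ys) || yscZ19s6.contains ys) = true := by decide +kernel

/-- Completeness at representative 6. [folklore] -/
theorem yscZ19s6_c6 : ((arr6Y2 19 [0,0,0,0,0,0,0,0,0,0,0,0,0,0,2,1,0,2,1]).all fun ys => !(dY6 ys) || yscZ19s6.contains ys) = true := by decide +kernel

/-- Completeness at representative 7. [folklore] -/
theorem yscZ19s6_c7 : ((arr6Y2 19 [0,0,0,0,0,0,0,0,0,0,0,0,0,1,0,2,1,0,2]).all fun ys => !(dY6 ys) || yscZ19s6.contains ys) = true := by decide +kernel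

/-- Completeness at representative 8. [folklore] -/
theorem yscZ19s6_c8 : ((arr6Y2 19 [0,0,0,0,0,0,0,0,0,0,0,0,0,1,1,0,1,2,1]).all fun ys => !(dY6 ys) || yscZ19s6.contains ys) = true := by decide +kernel

/-- Completeness at representative 9. [folklore] -/
theorem yscZ19s6_c9 : ((arr6Y2 19 [0,0,0,0,0,0,0,0,0,0,0,0,0,1,1,2,1,1,0]).all fun ys => !(dY6 ys) || yscZ19s6.contains ys) = true := by decide +kernel

/-- Completeness at representative 10. [folklore] -/
theorem yscZ19s6_c10 : ((arr6Y2 19 [0,0,0,0,0,0,0,0,0,0,0,0,0,1,2,1,0,1,1]).all fun ys => !(dY6 ys) || yscZ19s6.contains ys) = true := by decide +kernel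

/-- Completeness at representative 11. [folklore] -/
theorem yscZ19s6_c11 : ((arr6Y2 19 [0,0,0,0,0,0,0,0,0,0,0,0,0,1,2,2,1,0,0]).all fun ys => !(dY6 ys) || yscZ19s6.contains ys) = true := by decide +kernel

end ZpZpDomino

end Summit.MatrixMultiplication.OmegaCensus
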